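import Summits.QuantumFields.YangMills.Theorems.BalabanUVNodesN11TStepOldBranchInnerChart
import Summits.QuantumFields.YangMills.Theorems.BalabanUVNodesN11InnerPrivateCoordinateChartSocket

/-!
# DAG node N11 — (O3′) FROM THE OLD-BRANCH DATA, THE INSIDE STEP CHARTED IN PRIVATE COORDINATES: dag-n11-w6 g2's socket inhabitant (per-bond inversions of the (0.4) fibre maps
# off `sV′`) plugged into this seat's socket edition — `hin₀` GONE; what is displayed is the per-bond inversion data, the support ∕ measurability ∕ integrability rows, Theorem 1's
# level-`k` form, and ONE explicit integral identity per old branch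

HEADER — WORK-UNIT METADATA.  Cell `pub-ymgap`, YM-PLAN Track A (HUMAN RULING D-0062), seat `pub-ymgap-dag-n11-d` (g15; R134 fan-out base seat N11 [B14], strategy s2),
route `BalabanUVNodes` rev 28∕29, item K1⁹ `StabilityBRunRowsAtRecordR13SepCoPHV` = stmt-QuantumFields-27364 (dag-lead KEY MAP v2; helper lane, `--kind proof --supports 27364
--as helper`, count-neutral).  [I] = [Balaban1987RG1], [III] = [Balaban1988Convergent].  Composition of this seat's `…N11TStepOldBranchInnerChart` (★★★★★★
`slotsTOfRecord_succ_ae_eq_TkOfRecord_succ_of_oldBranchInnerChart`: (O3′) from the old-branch data with the inner readings supplied by ANY fibre-chart socket of the inside step)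
with dag-n11-w6 g2's `…N11InnerPrivateCoordinateChartSocket` (★★★ `hpush_innerPrivateChart`, ★★ `hfib_innerPrivateChart`, `measurable_innerPrivateChart ∕ …Jacobian`: the socket
INHABITED at the record's presentation by per-bond inversions `(Ω, T, ϑ, j)` of the one-variable (0.4) fibre maps at the central bonds of the coarse bonds OFF `sV′`).

WHY THIS FILE.  The two halves of (B4) meet: this seat's abstract half (socket p610288 → separated transport p614048∕p616225 → `genOp` junction p617211 → branch sum p619836 →
old-index reduction p622584∕`…OldBranchInnerSum`∕`…OldBranchInnerChart`) and the chart seats' concrete half (dag-n09-w6's triangular fibred chart p616307 → dag-n11-w6's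
private-coordinate charts p620673 ∕ `…KeptParameter` ∕ `…InnerPrivateCoordinateChartSocket`).  THIS FILE is the composition: (O3′)'s identity on the nose, for every history,
weights and r11-operand, from — (form) Theorem 1's level-`k` form at `init s′` (a.e. on the `χ_k`-support); (hG₀) per-old-branch graph integrability (= def-T's `hG` + positivity, this
seat's `…OldBranchGraphIntegrable`); THE PER-BOND INVERSION DATA `(Ω, T, ϑ, j; hΩm hTm hθm hjm hΩbl hright hlaw)` of dag-n11-w6 ∕ dag-n09-w6 (windows blind to the private
coordinates, a right inverse on the coarse window, the inverse change-of-variables law against one-bond Haar — dag-n09-w6's injectivity ∕ forward-Jacobian producers discharge them);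
(hwS) the step weight's graph section supported where every off-`sV′` central bond lies in its fine window ((3.2)–(3.5): the new small-field characteristic functions); measurability
of the weight's graph section ∕ `χ_k` ∕ the old weights' `ζ`, `w` ∕ the old operand; (hint) conditional integrability of the new inside integrands (dag-n11-w2's `hgm`∕`hI` edition is
one import away); and (hinner₀) ONE EXPLICIT INTEGRAL IDENTITY PER OLD BRANCH — for a.e. presented coarse point `q` and every inside fine `y` on the averaging fibre:
`∫ d(⊗_{b∉sV} Haar)(r) 𝟙[∀ c ∉ sV′, q.2 c ∈ T_c(e_β(y,r))]·∏_{c∉sV′} j_c(e_β(y,r), q.2 c) · G_{S₀}(e_β(y, r[β′c ↦ ϑ_c(e_β(y,r), q.2 c)]))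
   = Σ_Y ζ_k(ω_y)·(aOp k sA w_{S₀,Y} (𝐓_k(init s′,S₀)[W] Φ_{S₀ ∪ Y}))(ω_y)`
— the resampled outside-fibre integral of the old-branch piece against the `{S_j}`-indexed A-integrals of 11a's generation above it: [I] §2's change of variables from the resampled
central bonds to the fluctuation variables with its Jacobian, the gauge fixing (dag-n11-e p618524∕p620090∕p622555 rewrite the FP weight inside), `ζ`, and [III] Thm 2's
re-expansion of the new small-field integral.  DISPLAYED, not proved — it is N11's [III] §3 content at a 𝐓-present child, now stated between two explicit integrals.

WHAT THIS FILE PROVES (0 `def`, 0 `sorry`, standard axioms).  ★★★★★★★ `slotsTOfRecord_succ_ae_eq_TkOfRecord_succ_of_oldBranch_privateInnerChart`.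

HONEST FRAMING.  Helper lane of K1⁹; count-neutral; ONE composition BY NAME; per-bond inversion data, rows and the integral identity DISPLAYED; NO chart of Bałaban's ((47),
[III] (3.10)–(3.25)) asserted — a valid chart of the disintegration, not print's; NO Jacobian evaluated; NO Gaussian integration; nothing of [I] §2 ∕ [III] §3 ∕ Thm 2 asserted;
(B4) ∕ (S-α) ∕ (O3′) NOT closed; N11 NOT discharged; K1⁹ NOT closed, no registered stub touched; counts unmoved (typed 28∕28 · discharged 5∕27 · A 5∕28).  One finite `𝕋⁴_{L^K}`
programme at fixed `ε = L^{−K}`; R4 closes only the conditional finite-𝕋⁴ rung `BalabanLadder.UV` — NOT ℝ⁴, NOT OS, NOT a mass gap, NOT Clay.  No `sorry`, `axiom`, `def`, `instance`,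
`notation`.  Sources (SHAPE ∕ bookkeeping only): [I] (0.4) p.253, (2.4) p.266, (2.10) p.267; [III] (2.18) p.257, (2.20)–(2.21) p.258, (3.1) p.264, (3.2)–(3.5) p.265, (3.24)–(3.25) p.270, §3 p.279.
-/

noncomputable section

open MeasureTheory ProbabilityTheory Set Function
open scoped ENNReal NNReal BigOperators

namespace Summit.QuantumFields.YangMills.Theorems.BalabanUVNodesN11TStepOldBranchPrivateInnerChart

open Literature.MathematicalPhysics.QuantumFieldTheory.Balaban1983to89
open Literature.MathematicalPhysics.QuantumFieldTheory.Balaban1983to89.T4AveragingDisintegration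
open BalabanUVNodesN11TStepOldBranchInnerChart (slotsTOfRecord_succ_ae_eq_TkOfRecord_succ_of_oldBranchInnerChart)
open BalabanUVNodesN11InnerPrivateCoordinateChartSocket (hpush_innerPrivateChart hfib_innerPrivateChart measurable_innerPrivateChart measurable_innerPrivateJacobian)
open Literature.MathematicalPhysics.QuantumFieldTheory.Balaban1983to89.BlockAveragingHaarAC (centralBond)
open Node00 hiding SU
open Node00.Tk T4Continuum B14.Eq218Concrete
open B10Eq42TorusConstraint (bondsIn)

variable {F : T4Family} {N : ℕ} [NeZero N]
variable {V : Type} [NormedAddCommGroup V] [InnerProductSpace ℝ V] [FiniteDimensional ℝ V] [MeasurableSpace V] [BorelSpace V]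

/-- ★★★★★★★ **(O3′) ON THE NOSE, THE INSIDE STEP CHARTED IN PRIVATE COORDINATES.**  See the module docstring: `…OldBranchInnerChart` ★★★★★★ at dag-n11-w6 g2's socket
(`κ :=` the constant kernel `⊗_{b∉sV} Haar`, `Ψ ((y,v₂),r) := (y, r[β′c ↦ ϑ_c(e_β(y,r), v₂ c)])`, `J := 𝟙[∀ c ∉ sV′, v₂ c ∈ T_c]·∏ j_c`, charted set `{∀ c ∉ sV′, r(β′c) ∈ Ω_c(e_β(y,r))}`,
`hpush_innerPrivateChart` ∕ `hfib_innerPrivateChart`).  `hβ′` is dag-n11-w6's `centralBond_not_mem_of_not_mem` at the record's saturated `Y = (Ω_{k+1}(s′))ᶜ`.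
[cite: Balaban1987RG1, (0.4) p.253, (2.4) p.266, (2.10) p.267; Balaban1988Convergent, (2.18) p.257, (2.20)–(2.21) p.258, (3.1) p.264, (3.2)–(3.5) p.265, (3.24)–(3.25) p.270, §3 p.279] -/
theorem slotsTOfRecord_succ_ae_eq_TkOfRecord_succ_of_oldBranch_privateInnerChart (ν : Stage7Numerics) (τ : TowerNumerics) (E : B12.RunParams → ℝ)
    (w : StepWeightsOfRecord F N ν τ.M) (ppSel : PpSelOfRecord F ν τ.M) (p : B12.RunParams) (g : ℕ → ℝ) {k : ℕ} (hkK : k < p.K)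
    {hdec : DecidableEq (PBond (F.P p.K) k)} {hdec' : DecidableEq (PBond (F.P p.K) (k + 1))} (hk : k + 1 ≤ (F.P p.K).m + (F.P p.K).K)
    (s' : SeqOfRecord F ν τ.M g p.K (k + 1)) (W₀ W : TkWeights F N V p.K)
    (Φ₀ Φ : SFluct (F.P p.K) V → B15DeterminingSets.MSField (F.P p.K) (SU N) → ℝ)
    (hform : ∀ᵐ U ∂fieldMeasure (F.P p.K) k (SU N), chiSeqOfRecord F N ν τ.M g p.K k s'.init U ≠ 0 →
      slotsOfRecord F N ν τ E w ppSel p g k s'.init U = TkOfRecord F N V ν τ.M g p.K W₀ k s'.init Φ₀ U)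
    (hG₀ : ∀ S₀ ∈ admSOfRecord F ν τ.M g p.K k s'.init, Integrable (fun U => w p g k s' U ((avOfRecord F N p.K k).avg U) *
        (chiSeqOfRecord F N ν τ.M g p.K k s'.init U *
          tkBranchOfRecord F N V ν τ.M g p.K W₀ s'.init S₀ k (fun ω => Φ₀ (S₀, fun j => (ω j).2) (fun j => (ω j).1)) (baseCfg k U)))
      (fieldMeasure (F.P p.K) k (SU N)))
    -- dag-n11-w6 ∕ dag-n09-w6's per-bond inversion data of the (0.4) fibre maps, used only at the coarse bonds off `sV′`
    (hβ' : ∀ c : PBond (F.P p.K) (k + 1), c ∉ (Set.toFinite (bondsIn (k + 1) (s'.Ω (k + 1))ᶜ)).toFinset → centralBond c ∉ (Set.toFinite (bondsIn k (s'.Ω (k + 1))ᶜ)).toFinset)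
    (Ω T : PBond (F.P p.K) (k + 1) → GaugeField (F.P p.K) k (SU N) → Set (SU N))
    (ϑ : PBond (F.P p.K) (k + 1) → GaugeField (F.P p.K) k (SU N) → SU N → SU N)
    (jd : PBond (F.P p.K) (k + 1) → GaugeField (F.P p.K) k (SU N) → SU N → ℝ≥0)
    (hΩm : ∀ c, MeasurableSet {p : GaugeField (F.P p.K) k (SU N) × SU N | p.2 ∈ Ω c p.1})
    (hTm : ∀ c, MeasurableSet {p : GaugeField (F.P p.K) k (SU N) × SU N | p.2 ∈ T c p.1})
    (hθm : ∀ c, Measurable fun p : GaugeField (F.P p.K) k (SU N) × SU N => ϑ c p.1 p.2)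
    (hjm : ∀ c, Measurable fun p : GaugeField (F.P p.K) k (SU N) × SU N => jd c p.1 p.2)
    (hΩbl : ∀ c (U : GaugeField (F.P p.K) k (SU N)) (g' : PBond (F.P p.K) (k + 1) → SU N), Ω c (extend centralBond g' U) = Ω c U)
    (hright : ∀ c U, ∀ v ∈ T c U, (avOfRecord F N p.K k).avg (update U (centralBond c) (ϑ c U v)) c = v)
    (hlaw : ∀ c U, (HaarData.haar : Measure (SU N)).restrict (Ω c U) =
      (((HaarData.haar : Measure (SU N)).restrict (T c U)).withDensity fun v => (jd c U v : ℝ≥0∞)).map (ϑ c U))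
    -- the step weight's graph section lives where every off-`sV′` central bond lies in its fine window
    (hwS : ∀ q : (↥(Set.toFinite (bondsIn k (s'.Ω (k + 1))ᶜ)).toFinset → SU N) × ({b : PBond (F.P p.K) k // b ∉ (Set.toFinite (bondsIn k (s'.Ω (k + 1))ᶜ)).toFinset} → SU N),
      w p g k s' (⇑(MeasurableEquiv.piEquivPiSubtypeProd (fun _ : PBond (F.P p.K) k => SU N)
            (· ∈ (Set.toFinite (bondsIn k (s'.Ω (k + 1))ᶜ)).toFinset)).symm q) ((avOfRecord F N p.K k).avg (⇑(MeasurableEquiv.piEquivPiSubtypeProd (fun _ : PBond (F.P p.K) k => SU N)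
            (· ∈ (Set.toFinite (bondsIn k (s'.Ω (k + 1))ᶜ)).toFinset)).symm q)) ≠ 0 →
        ∀ c : {c : PBond (F.P p.K) (k + 1) // c ∉ (Set.toFinite (bondsIn (k + 1) (s'.Ω (k + 1))ᶜ)).toFinset}, q.2 ⟨centralBond (c : PBond (F.P p.K) (k + 1)), hβ' c c.2⟩ ∈ Ω c ((MeasurableEquiv.piEquivPiSubtypeProd (fun _ : PBond (F.P p.K) k => SU N) (· ∈ (Set.toFinite (bondsIn k (s'.Ω (k + 1))ᶜ)).toFinset)).symm q))
    (hwm : Measurable fun U => w p g k s' U ((avOfRecord F N p.K k).avg U)) (hχm : Measurable (chiSeqOfRecord F N ν τ.M g p.K k s'.init))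
    (hζm : ∀ j Y, Measurable (W₀.ζ j Y)) (hwWm : ∀ j Λ' Y S, Measurable (W₀.w j Λ' Y S))
    (hΦ₀m : ∀ S₀ ∈ admSOfRecord F ν τ.M g p.K k s'.init,
      Measurable fun ω : MultiCfg (F.P p.K) (SU N) V => Φ₀ (S₀, fun j => (ω j).2) (fun j => (ω j).1))
    (hint : ∀ᵐ q ∂((Measure.pi fun _ : ↥(Set.toFinite (bondsIn (k + 1) (s'.Ω (k + 1))ᶜ)).toFinset => (HaarData.haar : Measure (SU N))).prod
          (Measure.pi fun _ : {c : PBond (F.P p.K) (k + 1) // c ∉ (Set.toFinite (bondsIn (k + 1) (s'.Ω (k + 1))ᶜ)).toFinset} =>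
            (HaarData.haar : Measure (SU N)))),
      ∀ S ∈ admSOfRecord F ν τ.M g p.K (k + 1) s', Integrable
        (fun y : ↥(Set.toFinite (bondsIn k (s'.Ω (k + 1))ᶜ)).toFinset → SU N =>
          zetaOp (genDataOfRecord F N V ν τ.M g p.K W s' S k).ζ
            (aOp k (genDataOfRecord F N V ν τ.M g p.K W s' S k).sA (genDataOfRecord F N V ν τ.M g p.K W s' S k).w
              (tkBranchOfRecord F N V ν τ.M g p.K W s' S k (fun ω => Φ (S, fun j => (ω j).2) (fun j => (ω j).1))))
            (Function.update (baseCfg (k + 1) ((MeasurableEquiv.piEquivPiSubtypeProd (fun _ : PBond (F.P p.K) (k + 1) => SU N)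
                (· ∈ (Set.toFinite (bondsIn (k + 1) (s'.Ω (k + 1))ᶜ)).toFinset)).symm q)) k
              (Function.updateFinset ((baseCfg (V := V) (k + 1) ((MeasurableEquiv.piEquivPiSubtypeProd (fun _ : PBond (F.P p.K) (k + 1) => SU N)
                (· ∈ (Set.toFinite (bondsIn (k + 1) (s'.Ω (k + 1))ᶜ)).toFinset)).symm q)) k).1 (Set.toFinite (bondsIn k (s'.Ω (k + 1))ᶜ)).toFinset y,
                ((baseCfg (V := V) (k + 1) ((MeasurableEquiv.piEquivPiSubtypeProd (fun _ : PBond (F.P p.K) (k + 1) => SU N)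
                (· ∈ (Set.toFinite (bondsIn (k + 1) (s'.Ω (k + 1))ᶜ)).toFinset)).symm q)) k).2)))
        (condLaw (Measure.pi fun _ : ↥(Set.toFinite (bondsIn k (s'.Ω (k + 1))ᶜ)).toFinset => (HaarData.haar : Measure (SU N)))
          (avgRestrOfRecord F N p.K k (Set.toFinite (bondsIn k (s'.Ω (k + 1))ᶜ)).toFinset (Set.toFinite (bondsIn (k + 1) (s'.Ω (k + 1))ᶜ)).toFinset) q.1))
    -- THE EXPLICIT INTEGRAL IDENTITY PER OLD BRANCH ([I] §2 + gauge fixing + ζ + [III] Thm 2 — displayed)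
    (hinner₀ : ∀ᵐ q ∂((Measure.pi fun _ : ↥(Set.toFinite (bondsIn (k + 1) (s'.Ω (k + 1))ᶜ)).toFinset => (HaarData.haar : Measure (SU N))).prod
          (Measure.pi fun _ : {c : PBond (F.P p.K) (k + 1) // c ∉ (Set.toFinite (bondsIn (k + 1) (s'.Ω (k + 1))ᶜ)).toFinset} =>
            (HaarData.haar : Measure (SU N)))),
      ∀ S₀ ∈ admSOfRecord F ν τ.M g p.K k s'.init, ∀ y : ↥(Set.toFinite (bondsIn k (s'.Ω (k + 1))ᶜ)).toFinset → SU N,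
        avgRestrOfRecord F N p.K k (Set.toFinite (bondsIn k (s'.Ω (k + 1))ᶜ)).toFinset (Set.toFinite (bondsIn (k + 1) (s'.Ω (k + 1))ᶜ)).toFinset y = q.1 →
        (∫ r : ({b : PBond (F.P p.K) k // b ∉ (Set.toFinite (bondsIn k (s'.Ω (k + 1))ᶜ)).toFinset} → SU N), (({z : ((↥(Set.toFinite (bondsIn k (s'.Ω (k + 1))ᶜ)).toFinset → SU N) × ({c : PBond (F.P p.K) (k + 1) // c ∉ (Set.toFinite (bondsIn (k + 1) (s'.Ω (k + 1))ᶜ)).toFinset} → SU N)) × ({b : PBond (F.P p.K) k // b ∉ (Set.toFinite (bondsIn k (s'.Ω (k + 1))ᶜ)).toFinset} → SU N) |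
              ∀ c : {c : PBond (F.P p.K) (k + 1) // c ∉ (Set.toFinite (bondsIn (k + 1) (s'.Ω (k + 1))ᶜ)).toFinset}, z.1.2 c ∈ T c ((MeasurableEquiv.piEquivPiSubtypeProd (fun _ : PBond (F.P p.K) k => SU N) (· ∈ (Set.toFinite (bondsIn k (s'.Ω (k + 1))ᶜ)).toFinset)).symm (z.1.1, z.2))}.indicator
            (fun z => ∏ c : {c : PBond (F.P p.K) (k + 1) // c ∉ (Set.toFinite (bondsIn (k + 1) (s'.Ω (k + 1))ᶜ)).toFinset}, jd c ((MeasurableEquiv.piEquivPiSubtypeProd (fun _ : PBond (F.P p.K) k => SU N) (· ∈ (Set.toFinite (bondsIn k (s'.Ω (k + 1))ᶜ)).toFinset)).symm (z.1.1, z.2)) (z.1.2 c)) ((y, q.2), r) : ℝ≥0) : ℝ) *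
          ((fun U => w p g k s' U ((avOfRecord F N p.K k).avg U) *
        (chiSeqOfRecord F N ν τ.M g p.K k s'.init U *
          tkBranchOfRecord F N V ν τ.M g p.K W₀ s'.init S₀ k (fun ω => Φ₀ (S₀, fun j => (ω j).2) (fun j => (ω j).1)) (baseCfg k U))) ∘
            ⇑(MeasurableEquiv.piEquivPiSubtypeProd (fun _ : PBond (F.P p.K) k => SU N)
            (· ∈ (Set.toFinite (bondsIn k (s'.Ω (k + 1))ᶜ)).toFinset)).symm) (y, extend (fun c : {c : PBond (F.P p.K) (k + 1) // c ∉ (Set.toFinite (bondsIn (k + 1) (s'.Ω (k + 1))ᶜ)).toFinset} =>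
            (⟨centralBond (c : PBond (F.P p.K) (k + 1)), hβ' c c.2⟩ : {b : PBond (F.P p.K) k // b ∉ (Set.toFinite (bondsIn k (s'.Ω (k + 1))ᶜ)).toFinset}))
            (fun c : {c : PBond (F.P p.K) (k + 1) // c ∉ (Set.toFinite (bondsIn (k + 1) (s'.Ω (k + 1))ᶜ)).toFinset} => ϑ c ((MeasurableEquiv.piEquivPiSubtypeProd (fun _ : PBond (F.P p.K) k => SU N) (· ∈ (Set.toFinite (bondsIn k (s'.Ω (k + 1))ᶜ)).toFinset)).symm (y, r)) (q.2 c)) r) ∂(Measure.pi fun _ : {b : PBond (F.P p.K) k // b ∉ (Set.toFinite (bondsIn k (s'.Ω (k + 1))ᶜ)).toFinset} => (HaarData.haar : Measure (SU N)))) =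
          ∑ Y ∈ (Set.toFinite {Y : Set (Site (F.P p.K) 0) | Y ∈ SClassOfRecord F ν g p.K (k + 1) ∧ Y ⊆ s'.Ω (k + 1) ∩ (s'.Λ (k + 1))ᶜ}).toFinset,
            zetaOp (genDataOfRecord F N V ν τ.M g p.K W s' (Function.update S₀ (k + 1) Y) k).ζ
              (aOp k (genDataOfRecord F N V ν τ.M g p.K W s' (Function.update S₀ (k + 1) Y) k).sA
                (genDataOfRecord F N V ν τ.M g p.K W s' (Function.update S₀ (k + 1) Y) k).w
                (tkBranchOfRecord F N V ν τ.M g p.K W s'.init S₀ k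
                  (fun ω => Φ (Function.update S₀ (k + 1) Y, fun j => (ω j).2) (fun j => (ω j).1))))
              (Function.update (baseCfg (k + 1) ((MeasurableEquiv.piEquivPiSubtypeProd (fun _ : PBond (F.P p.K) (k + 1) => SU N)
                (· ∈ (Set.toFinite (bondsIn (k + 1) (s'.Ω (k + 1))ᶜ)).toFinset)).symm q)) k
              (Function.updateFinset ((baseCfg (V := V) (k + 1) ((MeasurableEquiv.piEquivPiSubtypeProd (fun _ : PBond (F.P p.K) (k + 1) => SU N)
                (· ∈ (Set.toFinite (bondsIn (k + 1) (s'.Ω (k + 1))ᶜ)).toFinset)).symm q)) k).1 (Set.toFinite (bondsIn k (s'.Ω (k + 1))ᶜ)).toFinset y,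
                ((baseCfg (V := V) (k + 1) ((MeasurableEquiv.piEquivPiSubtypeProd (fun _ : PBond (F.P p.K) (k + 1) => SU N)
                (· ∈ (Set.toFinite (bondsIn (k + 1) (s'.Ω (k + 1))ᶜ)).toFinset)).symm q)) k).2))) :
    slotsTOfRecord F N ν τ E w ppSel p g (k + 1) s' =ᵐ[fieldMeasure (F.P p.K) (k + 1) (SU N)] TkOfRecord F N V ν τ.M g p.K W (k + 1) s' Φ := by
  refine slotsTOfRecord_succ_ae_eq_TkOfRecord_succ_of_oldBranchInnerChart ν τ E w ppSel p g hkK (hdec := hdec) (hdec' := hdec') hk s' W₀ W Φ₀ Φ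
    hform hG₀
    (Kernel.const _ (Measure.pi fun _ : {b : PBond (F.P p.K) k // b ∉ (Set.toFinite (bondsIn k (s'.Ω (k + 1))ᶜ)).toFinset} => (HaarData.haar : Measure (SU N))))
    (Ψ := fun z : ((↥(Set.toFinite (bondsIn k (s'.Ω (k + 1))ᶜ)).toFinset → SU N) × ({c : PBond (F.P p.K) (k + 1) // c ∉ (Set.toFinite (bondsIn (k + 1) (s'.Ω (k + 1))ᶜ)).toFinset} → SU N)) × ({b : PBond (F.P p.K) k // b ∉ (Set.toFinite (bondsIn k (s'.Ω (k + 1))ᶜ)).toFinset} → SU N) => (z.1.1, extend (fun c : {c : PBond (F.P p.K) (k + 1) // c ∉ (Set.toFinite (bondsIn (k + 1) (s'.Ω (k + 1))ᶜ)).toFinset} =>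
            (⟨centralBond (c : PBond (F.P p.K) (k + 1)), hβ' c c.2⟩ : {b : PBond (F.P p.K) k // b ∉ (Set.toFinite (bondsIn k (s'.Ω (k + 1))ᶜ)).toFinset}))
            (fun c : {c : PBond (F.P p.K) (k + 1) // c ∉ (Set.toFinite (bondsIn (k + 1) (s'.Ω (k + 1))ᶜ)).toFinset} => ϑ c ((MeasurableEquiv.piEquivPiSubtypeProd (fun _ : PBond (F.P p.K) k => SU N) (· ∈ (Set.toFinite (bondsIn k (s'.Ω (k + 1))ᶜ)).toFinset)).symm (z.1.1, z.2)) (z.1.2 c)) z.2))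
    (measurable_fst.fst.prodMk (measurable_innerPrivateChart (F := F) (N := N) ϑ hk hβ' hθm))
    (J := fun z => ({z : ((↥(Set.toFinite (bondsIn k (s'.Ω (k + 1))ᶜ)).toFinset → SU N) × ({c : PBond (F.P p.K) (k + 1) // c ∉ (Set.toFinite (bondsIn (k + 1) (s'.Ω (k + 1))ᶜ)).toFinset} → SU N)) × ({b : PBond (F.P p.K) k // b ∉ (Set.toFinite (bondsIn k (s'.Ω (k + 1))ᶜ)).toFinset} → SU N) |
              ∀ c : {c : PBond (F.P p.K) (k + 1) // c ∉ (Set.toFinite (bondsIn (k + 1) (s'.Ω (k + 1))ᶜ)).toFinset}, z.1.2 c ∈ T c ((MeasurableEquiv.piEquivPiSubtypeProd (fun _ : PBond (F.P p.K) k => SU N) (· ∈ (Set.toFinite (bondsIn k (s'.Ω (k + 1))ᶜ)).toFinset)).symm (z.1.1, z.2))}.indicator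
            (fun z => ∏ c : {c : PBond (F.P p.K) (k + 1) // c ∉ (Set.toFinite (bondsIn (k + 1) (s'.Ω (k + 1))ᶜ)).toFinset}, jd c ((MeasurableEquiv.piEquivPiSubtypeProd (fun _ : PBond (F.P p.K) k => SU N) (· ∈ (Set.toFinite (bondsIn k (s'.Ω (k + 1))ᶜ)).toFinset)).symm (z.1.1, z.2)) (z.1.2 c)) z : ℝ≥0))
    (measurable_innerPrivateJacobian (F := F) (N := N) T jd hTm hjm)
    (hpush_innerPrivateChart (F := F) (N := N) Ω T ϑ jd hkK hβ' hΩm hTm hθm hjm hΩbl hright hlaw)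
    ((hfib_innerPrivateChart (F := F) (N := N) T ϑ jd hkK hβ' hTm hjm hright _).mono fun z hz => Prod.ext rfl hz)
    (fun q hq => ?_) hwm hχm hζm hwWm hΦ₀m hint ?_
  · -- support: off the charted set some off-`sV′` central bond is outside its window, so the step weight vanishes
    by_contra hw0
    exact hq (hwS q hw0)
  · filter_upwards [hinner₀] with q hq S₀ h₀ y hy
    rw [Kernel.const_apply]
    exact hq S₀ h₀ y hy

end Summit.QuantumFields.YangMills.Theorems.BalabanUVNodesN11TStepOldBranchPrivateInnerChart

end
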